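import Summits.ResolutionOfSingularities.ResolutionOfSingularities.Theorems.MarkedTransferCampaignW46ThreefoldsGammaFreeGlobalPatching
import HarnessLib

/-!
# [OURS · L1 W4.6 rung (ii)] FINITE PATCHING: order-reducibility from finitely many open pieces around pairwise separated
# parts of the order-`≥ m` locus, PROVED (any dimension)

Cell res-hironaka, LADDER-RESOLUTION rung L (D-0089), slot W4.6, rung (ii) (threefold hypersurfaces); seat res-L1-s46-pv-3
(gen 3). Host route MarkedTransfer, host item `HypersurfaceOrderReductionDimLeThree` (stmt-ResolutionOfSingularities-16156);
filed `--kind proof --supports` it `--as helper`. OURS scheme theory over the campaign predicate (`CampaignW46.OrderReducible`,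
p496755); nothing of H. Hironaka's manuscript is asserted. AI-written; AI review is weaker than expert review.
Sequel of `…GammaFreeGlobalPatching.lean` (relative extension + two pieces): the `n`-piece statement, by induction on `n`
with the scheme changing at each round.

## What is proved (no new definitions)

* `CampaignW46.OrderReducible.transport_piece` — after a relative round over a piece `Z₀` (data: `Φ : X₁ → X` with
  `Φ⁻¹(X ∖ Z₀) ↪ X₁ → X` an open immersion and `J₁|_{Φ⁻¹(X ∖ Z₀)} = ` pull-back of `J`), an order reduction of `J` on an
  open `V ⊆ X ∖ Z₀` transports to one of `J₁` on `Φ⁻¹ V`.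
* `CampaignW46.OrderReducible.idealOrder_eq_of_not_mem_range` — after such a round, a point of `X₁` not in the image of
  the piece's last stage lies over `X ∖ Z₀` and has the order of `J` at its image.
* `CampaignW46.OrderReducible.of_finite_of_forall_nhds` — **pointwise-local order-reducibility suffices when the order-`≥ m`
  locus is a finite set of closed points** (isolated regime: one open chart around each bad point).
* `CampaignW46.OrderReducible.of_opens_finite` — **FINITE PATCHING**: `X` regular locally Noetherian, `J`, `m`; pieces
  `(Vᵢ, Zᵢ)_{i < n}` with `Vᵢ ⊆ X` open, `Zᵢ ⊆ Vᵢ` closed, `Zᵢ ∩ Vⱼ = ∅` for `i ≠ j`, every point of order `≥ m` in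
  `⋃ᵢ Zᵢ`, and `(Vᵢ, J|_{Vᵢ}, m)` order-reducible for every `i` ⇒ `(X, J, m)` order-reducible. (Round on piece `0` by the
  relative extension lemma; the other pieces pull back to the first extension's last stage, where they satisfy the same
  hypotheses; induction on `n`; `n = 0`: no point of order `≥ m`.)

HONEST VALUE. Glue, not a rung: «order-reducible» is a property that may be verified separately on an open neighbourhood
of each of finitely many pairwise separated parts of `Sing(J, m)` — the form in which slices of the `d = 3` statement
(monomial / cylinder / maximal-contact charts) combine, and hypothesis (α) of the tame-double-point design memo
(L/res-L1-s46-pv-3/RUNG-II-gen3.md).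

References: `…GammaFreeGlobalPatching.lean` (this seat: `IsPermissibleBlowupSeq.exists_extension_of_isOpenImmersion_rel`),
`…GammaFreeGlobalLocal.lean` (p500913, res-D-pv-049), `…GammaFreeGlobalEtale.lean` (p500660), `…GammaFreeGlobalLadder.lean`
(p496755); tree `Resolution/MarkedIdealsEtale.lean` (`idealOrder_comap_of_etale`) [Piltant2013, Prop. 5.1] [GortzWedhorn2020,
Prop. 13.91]. H. Hironaka, ms. 2017-03-23, Def. 2.4 p.6 — scope only, under adjudication, not cited as fact. [Hironaka2017]
-/

noncomputable section

set_option linter.dupNamespace false -- mandated namespace of this single-conjunct summit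

open CategoryTheory CategoryTheory.Limits AlgebraicGeometry TopologicalSpace IsLocalRing

namespace Summit.ResolutionOfSingularities.ResolutionOfSingularities.Theorems

namespace CampaignW46

open Literature.AlgebraicGeometry.Resolution
open Scheme.IdealSheafData

universe u

namespace OrderReducible

/-- **Transport of a piece after a relative round.** `Φ : X₁ → X` with `(Φ⁻¹ O ↪ X₁) ≫ Φ` an open immersion and
`J₁|_{Φ⁻¹ O}` the pull-back of `J` (`O ⊆ X` open); then for every open `V ≤ O`, an order reduction of `(V, J|_V, m)`
transports to one of `(Φ⁻¹V, J₁|_{Φ⁻¹V}, m)` — along `Φ ∣_ V`, an open immersion. [cite: GortzWedhorn2020, Prop. 13.91] -/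
theorem transport_piece {X₁ X : Scheme.{u}} [IsLocallyNoetherian X] (Φ : X₁ ⟶ X) (J : X.IdealSheafData)
    (J₁ : X₁.IdealSheafData) {m : ℕ} (O : X.Opens) (hopen : IsOpenImmersion ((Φ ⁻¹ᵁ O).ι ≫ Φ))
    (hJO : J₁.comap (Φ ⁻¹ᵁ O).ι = J.comap ((Φ ⁻¹ᵁ O).ι ≫ Φ)) (V : X.Opens) (hVO : V ≤ O)
    (h : OrderReducible (J.comap V.ι) m) : OrderReducible (J₁.comap (Φ ⁻¹ᵁ V).ι) m := by
  haveI := hopen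
  have hle : Φ ⁻¹ᵁ V ≤ Φ ⁻¹ᵁ O := fun x hx => hVO hx
  have hfacV : (Φ ⁻¹ᵁ V).ι ≫ Φ = X₁.homOfLE hle ≫ ((Φ ⁻¹ᵁ O).ι ≫ Φ) := by
    rw [← Category.assoc, Scheme.homOfLE_ι]
  haveI hopenV : IsOpenImmersion ((Φ ⁻¹ᵁ V).ι ≫ Φ) := by rw [hfacV]; infer_instance
  haveI : IsOpenImmersion (Φ ∣_ V) := by
    have h1 : IsOpenImmersion ((Φ ∣_ V) ≫ V.ι) := by rw [morphismRestrict_ι]; exact hopenV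
    exact IsOpenImmersion.of_comp (Φ ∣_ V) V.ι
  have hJV : J₁.comap (Φ ⁻¹ᵁ V).ι = J.comap ((Φ ⁻¹ᵁ V).ι ≫ Φ) := by
    rw [hfacV, Scheme.IdealSheafData.comap_comp, ← hJO, ← Scheme.IdealSheafData.comap_comp, Scheme.homOfLE_ι]
  have h' := OrderReducible.comap_of_etale (Φ ∣_ V) h
  rwa [← Scheme.IdealSheafData.comap_comp, morphismRestrict_ι, ← hJV] at h'

/-- After a relative round over `Z₀` (image `u′` of the piece's last stage, every point over `Z₀` in it, open-immersion and
pull-back invariants over `O = X ∖ Z₀`): a point of `X₁` NOT in the image of `u′` lies over `O` and the order of `J₁` there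
is the order of `J` at its image. [cite: BierstoneGrigorievMilmanWlodarczyk2011, Lemma 8.0.3 (2)] -/
theorem idealOrder_eq_of_not_mem_range {V' X₁ X : Scheme.{u}} [IsLocallyNoetherian X] (Φ : X₁ ⟶ X)
    (J : X.IdealSheafData) (J₁ : X₁.IdealSheafData) (u' : V' ⟶ X₁) (Z₀ : Set X) (hZ₀ : IsClosed Z₀)
    (hb : ∀ x' : X₁, Φ x' ∈ Z₀ → x' ∈ Set.range u')
    (hopen : IsOpenImmersion ((Φ ⁻¹ᵁ ⟨Z₀ᶜ, hZ₀.isOpen_compl⟩).ι ≫ Φ))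
    (hJO : J₁.comap (Φ ⁻¹ᵁ ⟨Z₀ᶜ, hZ₀.isOpen_compl⟩).ι = J.comap ((Φ ⁻¹ᵁ ⟨Z₀ᶜ, hZ₀.isOpen_compl⟩).ι ≫ Φ))
    {x₁ : X₁} (hx : x₁ ∉ Set.range u') : Φ x₁ ∉ Z₀ ∧ idealOrder J₁ x₁ = idealOrder J (Φ x₁) := by
  haveI := hopen
  have hxO : x₁ ∈ Φ ⁻¹ᵁ ⟨Z₀ᶜ, hZ₀.isOpen_compl⟩ := fun hxZ => hx (hb x₁ hxZ)
  refine ⟨hxO, ?_⟩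
  have h1 := idealOrder_comap_of_etale (Φ ⁻¹ᵁ ⟨Z₀ᶜ, hZ₀.isOpen_compl⟩).ι J₁ ⟨x₁, hxO⟩
  have h2 := idealOrder_comap_of_etale ((Φ ⁻¹ᵁ ⟨Z₀ᶜ, hZ₀.isOpen_compl⟩).ι ≫ Φ) J ⟨x₁, hxO⟩
  rw [hJO] at h1
  rw [h1] at h2
  exact h2

/-- **FINITE PATCHING OF ORDER-REDUCIBILITY.** `X` regular locally Noetherian, `J` an ideal sheaf, `m : ℕ`, and `n`
pieces `(Vᵢ, Zᵢ)`: `Vᵢ ⊆ X` open, `Zᵢ` closed with `Zᵢ ⊆ Vᵢ`, `Zᵢ ∩ Vⱼ = ∅` for `i ≠ j`, every point of `X` of order `≥ m`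
in some `Zᵢ`. If `(Vᵢ, J|_{Vᵢ}, m)` is order-reducible for every `i`, then `(X, J, m)` is order-reducible.
[cite: Piltant2013, Prop. 5.1 (proof, Step 2)] -/
theorem of_opens_finite :
    ∀ (n : ℕ) {X : Scheme.{u}} [IsLocallyNoetherian X], Scheme.IsRegular X → ∀ (J : X.IdealSheafData) (m : ℕ)
      (V : Fin n → X.Opens) (Z : Fin n → Set X), (∀ i, IsClosed (Z i)) → (∀ i, Z i ⊆ (V i : Set X)) →
      (∀ i j, i ≠ j → Disjoint (Z i) (V j : Set X)) →
      (∀ x : X, (m : ℕ∞) ≤ idealOrder J x → ∃ i, x ∈ Z i) →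
      (∀ i, OrderReducible (J.comap (V i).ι) m) → OrderReducible J m := by
  intro n
  induction n with
  | zero =>
    intro X _ hX J m V Z hZc hZV hdisj hJZ hV
    refine OrderReducible.of_forall_lt fun x => ?_
    by_contra hge
    rw [not_lt] at hge
    obtain ⟨i, -⟩ := hJZ x hge
    exact Fin.elim0 i
  | succ n ih =>
    intro X _ hX J m V Z hZc hZV hdisj hJZ hV
    -- round on piece `0`
    obtain ⟨V₀', σ₀, K₀', hseqV₀, hltV₀⟩ := hV 0
    have hJZ₀ : ∀ y : ↥(V 0), (m : ℕ∞) ≤ idealOrder J ((V 0).ι y) → (V 0).ι y ∈ Z 0 := by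
      intro y hy
      obtain ⟨i, hi⟩ := hJZ _ hy
      by_cases hi0 : i = 0
      · subst hi0; exact hi
      · exact absurd y.2 (Set.disjoint_left.mp (hdisj i 0 hi0) hi)
    obtain ⟨X₁, Φ₁, J₁, u₁', hseq₁, hu₁', -, hK₁, -, hb₁, hopen₁, hJO₁⟩ :=
      IsPermissibleBlowupSeq.exists_extension_of_isOpenImmersion_rel hX (V 0).ι J m (Z 0) (hZc 0) hJZ₀
        (by rw [Scheme.Opens.range_ι]; exact hZV 0) hseqV₀
    haveI := hu₁'
    obtain ⟨hN₁, hX₁⟩ := hseq₁.isLocallyNoetherian_and_isRegular inferInstance hX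
    haveI := hN₁
    set O : X.Opens := ⟨(Z 0)ᶜ, (hZc 0).isOpen_compl⟩ with hO
    -- the remaining pieces, pulled back to `X₁`
    have hVO : ∀ i : Fin n, V i.succ ≤ O := fun i x hx hxZ =>
      Set.disjoint_left.mp (hdisj 0 i.succ (Fin.succ_ne_zero i).symm) hxZ hx
    have hred : OrderReducible J₁ m := by
      refine ih hX₁ J₁ m (fun i => Φ₁ ⁻¹ᵁ V i.succ) (fun i => Φ₁ ⁻¹' Z i.succ)
        (fun i => (hZc i.succ).preimage Φ₁.continuous) (fun i x hx => hZV i.succ hx)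
        (fun i j hij => ?_) (fun x₁ hx₁ => ?_) (fun i => ?_)
      · exact (hdisj i.succ j.succ fun h => hij (Fin.succ_injective _ h)).preimage Φ₁
      · -- points of `X₁` of order `≥ m` lie over some `Zᵢ`, `i ≥ 1`
        by_cases hr : x₁ ∈ Set.range u₁'
        · obtain ⟨y, rfl⟩ := hr
          have hy := hltV₀ y
          rw [hK₁, idealOrder_comap_of_etale u₁' J₁ y] at hy
          exact absurd hx₁ (not_le.mpr hy)
        · obtain ⟨hxO, hord⟩ := idealOrder_eq_of_not_mem_range Φ₁ J J₁ u₁' (Z 0) (hZc 0) hb₁ hopen₁ hJO₁ hr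
          rw [hord] at hx₁
          obtain ⟨i, hi⟩ := hJZ _ hx₁
          have hi0 : i ≠ 0 := by rintro rfl; exact hxO hi
          obtain ⟨j, rfl⟩ := Fin.exists_succ_eq.mpr hi0
          exact ⟨j, hi⟩
      · exact transport_piece Φ₁ J J₁ O hopen₁ hJO₁ (V i.succ) (hVO i) (hV i.succ)
    exact OrderReducible.of_isPermissibleBlowupSeq hseq₁ hred

/-- **POINTWISE-LOCAL ORDER-REDUCIBILITY SUFFICES WHEN THE ORDER-`≥ m` LOCUS IS FINITE.** `X` regular locally Noetherian,
`J`, `m`; suppose the points of order `≥ m` lie in a FINITE set `S` of CLOSED points and every `x ∈ S` has an open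
neighbourhood `V ∋ x` with `(V, J|_V, m)` order-reducible. Then `(X, J, m)` is order-reducible. (Shrink each `V_x` off
the other points of `S`; finite patching with `Zₓ = {x}`.) This is the form in which chart-wise results (a maximal-contact
chart, a monomial chart, a cylinder chart around each isolated bad point) settle an input with isolated order-`≥ m` locus.
[cite: Piltant2013, Prop. 5.1 (proof, Step 2)] -/
theorem of_finite_of_forall_nhds {X : Scheme.{u}} [IsLocallyNoetherian X] (hX : Scheme.IsRegular X)
    (J : X.IdealSheafData) {m : ℕ} (S : Set X) (hS : S.Finite) (hSc : ∀ x ∈ S, IsClosed ({x} : Set X))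
    (hJS : ∀ x : X, (m : ℕ∞) ≤ idealOrder J x → x ∈ S)
    (hloc : ∀ x ∈ S, ∃ V : X.Opens, x ∈ V ∧ OrderReducible (J.comap V.ι) m) : OrderReducible J m := by
  classical
  obtain ⟨n, f, hf⟩ := hS.fin_embedding
  have hfS : ∀ i, f i ∈ S := fun i => hf ▸ Set.mem_range_self i
  choose V hxV hV using fun i => hloc (f i) (hfS i)
  -- shrink `V i` off the other points of `S`
  have hcl : ∀ i : Fin n, IsClosed (⋃ j ∈ {j : Fin n | j ≠ i}, ({f j} : Set X)) := fun i =>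
    (Set.toFinite _).isClosed_biUnion fun j _ => hSc (f j) (hfS j)
  let W : Fin n → X.Opens := fun i =>
    ⟨(V i : Set X) \ ⋃ j ∈ {j : Fin n | j ≠ i}, ({f j} : Set X), (V i).2.sdiff (hcl i)⟩
  have hWV : ∀ i, W i ≤ V i := fun i x hx => hx.1
  have hxW : ∀ i, f i ∈ W i := by
    intro i
    refine ⟨hxV i, ?_⟩
    simp only [Set.mem_setOf_eq, Set.mem_iUnion, Set.mem_singleton_iff, exists_prop, not_exists, not_and]
    intro j hj hij
    exact hj (f.injective hij.symm)
  have hW : ∀ i, OrderReducible (J.comap (W i).ι) m := by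
    intro i
    have h := OrderReducible.comap_of_etale (X.homOfLE (hWV i)) (hV i)
    rwa [← Scheme.IdealSheafData.comap_comp, Scheme.homOfLE_ι] at h
  refine of_opens_finite n hX J m W (fun i => {f i}) (fun i => hSc (f i) (hfS i))
    (fun i => Set.singleton_subset_iff.mpr (hxW i)) (fun i j hij => ?_) (fun x hx => ?_) hW
  · rw [Set.disjoint_singleton_left]
    intro hmem
    have h2 := hmem.2
    simp only [Set.mem_setOf_eq, Set.mem_iUnion, Set.mem_singleton_iff, exists_prop, not_exists, not_and] at h2
    exact h2 i hij rfl
  · have hxS := hJS x hx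
    rw [← hf] at hxS
    obtain ⟨i, rfl⟩ := hxS
    exact ⟨i, rfl⟩

end OrderReducible

end CampaignW46

end Summit.ResolutionOfSingularities.ResolutionOfSingularities.Theorems

end
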